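import Mathlib

/-!
# BN-C1 (chord-idea-2 g1): the PAIR-LIST FLOOR for generator-basis rewrites of a Gram certificate

If a block dual `Z` (indexed by words `n`) is rewritten in ANY generator basis as a sandwich
`Z = Gᵀ C G` (`G : Matrix r n ℚ`, row `a` = coefficients of generator `g_a` over the words;
`C : Matrix r r ℚ` the Gram matrix in that basis; the factor form is `C` diagonal), then every
nonzero word pair `(i, j)` of `Z` is produced by some coupled generator pair `(a, b)` with
`C a b ≠ 0`, `i ∈ supp g_a`, `j ∈ supp g_b`.  Hence the distinct word pairs a replay checker must
normal-order contain `supp Z`: no basis change takes the pair list below `nnz_word(Z)`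
(ADDENDUM-chordidea2-g1.md §C1; ANATOMY-v0′ puts nnz_word(Z)/pairs ≳ 0.7 at loss ≤ 4e-4).
Pure linear algebra over ℚ; no summit statement is touched.
-/

namespace Summit.Ventures.CertifiedManyBodySolver.Cruxes.LowerEdge_ge_m4o5.ChordIdea2PairFloor

open Matrix

variable {n r : Type*} [Fintype r]

/-- The sandwich rewrite `Z = Gᵀ C G` of a word-indexed matrix in a generator basis. -/
def sandwich (C : Matrix r r ℚ) (G : Matrix r n ℚ) : Matrix n n ℚ := Gᵀ * C * G

theorem sandwich_apply (C : Matrix r r ℚ) (G : Matrix r n ℚ) (i j : n) :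
    sandwich C G i j = ∑ b, (∑ a, G a i * C a b) * G b j := by
  simp [sandwich, Matrix.mul_apply, Matrix.transpose_apply]

/-- PAIR-LIST FLOOR, pointwise form: a nonzero word pair of `Gᵀ C G` is covered by the supports of
some coupled generator pair. -/
theorem exists_generators_of_sandwich_ne_zero (C : Matrix r r ℚ) (G : Matrix r n ℚ) (i j : n)
    (h : sandwich C G i j ≠ 0) : ∃ a b : r, C a b ≠ 0 ∧ G a i ≠ 0 ∧ G b j ≠ 0 := by
  by_contra hcon
  push Not at hcon
  apply h
  rw [sandwich_apply]
  apply Finset.sum_eq_zero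
  intro b _
  rw [Finset.sum_mul]
  apply Finset.sum_eq_zero
  intro a _
  by_cases h1 : C a b = 0
  · simp [h1]
  by_cases h2 : G a i = 0
  · simp [h2]
  simp [hcon a b h1 h2]

open Classical in
/-- PAIR-LIST FLOOR, counting form: `nnz(Z)` ≤ number of word pairs covered by coupled generator
supports (`⋃_{C a b ≠ 0} supp g_a × supp g_b`). For the factor form (`C` diagonal) the right side is
`⋃_a supp g_a × supp g_a`, whose size is at most `Σ_a |supp g_a|²` = the factor-expanded product count. -/
theorem card_support_le_card_covered [Fintype n] (C : Matrix r r ℚ) (G : Matrix r n ℚ) :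
    (Finset.univ.filter (fun p : n × n => sandwich C G p.1 p.2 ≠ 0)).card ≤
    (Finset.univ.filter
      (fun p : n × n => ∃ a b : r, C a b ≠ 0 ∧ G a p.1 ≠ 0 ∧ G b p.2 ≠ 0)).card := by
  apply Finset.card_le_card
  intro p hp
  simp only [Finset.mem_filter, Finset.mem_univ, true_and] at hp ⊢
  exact exists_generators_of_sandwich_ne_zero C G p.1 p.2 hp

/-- Toy instance (decidable check): one generator `g = e₀ + e₁` over two words with `C = (1)` gives
`Z = [[1,1],[1,1]]` — all 4 word pairs nonzero, all 4 covered. -/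
example : sandwich (r := Fin 1) (n := Fin 2) !![(1 : ℚ)] !![1, 1] = !![1, 1; 1, 1] := by
  ext i j
  fin_cases i <;> fin_cases j <;> simp [sandwich_apply]

end Summit.Ventures.CertifiedManyBodySolver.Cruxes.LowerEdge_ge_m4o5.ChordIdea2PairFloor
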